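import Literature.NumberTheory.GaloisRepresentations.SerreWeight
import Literature.NumberTheory.GaloisRepresentations.LocalFieldPadicProofs
import HarnessLib

/-!
# The `p`-adic local restriction datum on Mathlib's `ℚ_[p]` (Serre's weight at the place `p`)

Companion of `Literature.NumberTheory.GaloisRepresentations.SerreWeight` (item C16).  There the
global Serre weight `serreWeight p ρ̄ loc ι` of `ρ̄ : Γ_ℚ → GL₂(k)` is computed from an abstract
*local restriction datum* `loc : LocalRestrictionAt p ρ̄` — a non-archimedean local field `F ⊇ ℚ`
with residue field of cardinality `p` and uniformiser `p` (so `F ≅ ℚ_p`) carrying `ρ̄|Γ_F` —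
because Mathlib has no `IsNonarchimedeanLocalField ℚ_[p]` instance.  Since the tree PROVES
`Padic.isNonarchimedeanLocalField_holds` together with `Padic.residueFieldCard_eq`
(`residueFieldCard ℚ_[p] = p`) and `Padic.irreducible_natCast_valuationInteger`
(`Irreducible (p : 𝒪[ℚ_[p]])`) in `LocalFieldPadicProofs.lean`, the canonical datum on Mathlib's own
`ℚ_[p]` can be written down; this file does so (two definitions + unfolding lemmas, nothing of
`LocalFieldPadicProofs.lean` restated):

* `padicIntEquivInteger p : ℤ_[p] ≃+* 𝒪[ℚ_[p]]` — the DATA version of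
  `Padic.nonempty_valuationInteger_ringEquiv_padicInt` (a theorem of the proofs file
  `LocalFieldPadicProofs.lean`, which may declare no data): it is the inverse of the witness used
  there, the identity on elements (`Padic.mem_valuationInteger_iff`: `𝒪[ℚ_[p]] = {‖x‖ ≤ 1}`); it
  bridges Mathlib's `PadicInt` API (`PadicInt.irreducible_p`, `PadicInt.residueField`, the ring
  homomorphisms `PadicInt.toZMod`, `PadicInt.toZModPow`, …) to the `𝒪[F]`-based API of the
  local-field files;
* `LocalRestrictionAt.padic p ρ̄ : LocalRestrictionAt p ρ̄` with `F = ℚ_[p]`,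
  `rep = ρ̄.restrictField ℚ_[p]` (the restriction along the tree's fixed
  `absGaloisRestrict ℚ ℚ_[p] : Γ_{ℚ_p} → Γ_ℚ`, a decomposition group at a place of `ℚ̄` above `p`;
  Serre, Duke Math. J. 54 (1987), §2.1: "le choix d'une place de `ℚ̄` prolongeant `p`"), so that
  `serreWeight p ρ̄ (LocalRestrictionAt.padic p ρ̄) ι` is Serre's `k(ρ̄)` read at the `p`-adic place.

(The existence of *some* datum, built on the completion `v.adicCompletion ℚ` at the place `v ↔ p`,
is `Automorphic.nonempty_localRestrictionAt` of `Automorphic/SerreConjectureProofs.lean`; the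
present file gives the explicit `ℚ_[p]`-model and the `ℤ_[p]`-bridge.)
No named fact and no instance: the local-field structure of `ℚ_[p]` enters as the theorem
`Padic.isNonarchimedeanLocalField_holds` (outline GalRep D4), passed explicitly.

## References

* [Serre1987] J.-P. Serre, *Sur les représentations modulaires de degré 2 de Gal(ℚ̄/ℚ)*, Duke
  Math. J. 54 (1987), §2.1 (`G_p`, the place above `p`), §2.2–2.4 (`k(ρ)`).
* [SerreLocalFields1979] J.-P. Serre, *Local Fields*, GTM 67 (1979), Ch. II §1 (`ℚ_p`: valuation
  ring `ℤ_p`, residue field `𝔽_p`, uniformiser `p`).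
-/

noncomputable section

open ValuativeRel Field

namespace Literature.NumberTheory.GaloisRepresentations

open IsNonarchimedeanLocalField

universe v

/-! ### `ℤ_[p]` as the valuation ring of Mathlib's `ℚ_[p]` (data) -/

namespace Padic

variable (p : ℕ) [Fact p.Prime]

/-- **`ℤ_[p] ≃+* 𝒪[ℚ_[p]]`** (data): Mathlib's `p`-adic integers are the valuation ring of the
valuative relation on `ℚ_[p]` — both are the closed unit ball (`Padic.mem_valuationInteger_iff`),
and the map is the identity on elements.  This is the data version, and the inverse, of the
witness of the theorem `Padic.nonempty_valuationInteger_ringEquiv_padicInt`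
(`LocalFieldPadicProofs.lean`, a proofs file declaring no data).
Ref: Serre, *Local Fields*, Ch. II §1. [folklore] -/
def padicIntEquivInteger : ℤ_[p] ≃+* 𝒪[ℚ_[p]] where
  toFun z := ⟨z, (mem_valuationInteger_iff p (z : ℚ_[p])).mpr z.2⟩
  invFun x := ⟨x, (mem_valuationInteger_iff p (x : ℚ_[p])).mp x.2⟩
  left_inv _ := rfl
  right_inv _ := rfl
  map_mul' _ _ := rfl
  map_add' _ _ := rfl

/-- Underlying element of `padicIntEquivInteger p z` is `z`. [folklore] -/
@[simp] theorem coe_padicIntEquivInteger (z : ℤ_[p]) :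
    ((padicIntEquivInteger p z : 𝒪[ℚ_[p]]) : ℚ_[p]) = z := rfl

/-- Underlying element of `(padicIntEquivInteger p).symm x` is `x`. [folklore] -/
@[simp] theorem coe_padicIntEquivInteger_symm (x : 𝒪[ℚ_[p]]) :
    (((padicIntEquivInteger p).symm x : ℤ_[p]) : ℚ_[p]) = x := rfl

/-- `padicIntEquivInteger p` sends the natural number `n` to `n`. [folklore] -/
@[simp] theorem padicIntEquivInteger_natCast (n : ℕ) :
    padicIntEquivInteger p (n : ℤ_[p]) = (n : 𝒪[ℚ_[p]]) :=
  map_natCast _ n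

end Padic

/-! ### The local restriction datum at `p` on `ℚ_[p]` -/

namespace ModPGaloisRep

variable {k : Type v} [Field k] [TopologicalSpace k]

/-- **The `p`-adic local restriction datum** of a global mod `p` representation
`ρ̄ : Γ_ℚ → GL₂(k)`: `F = ℚ_[p]` with Mathlib's valuative relation and metric topology — a
non-archimedean local field by the theorem `Padic.isNonarchimedeanLocalField_holds`, residue
field of cardinality `p` (`Padic.residueFieldCard_eq`), uniformiser `p`
(`Padic.irreducible_natCast_valuationInteger`) — and `rep = ρ̄.restrictField ℚ_[p]`, the
restriction of `ρ̄` along the tree's fixed `absGaloisRestrict ℚ ℚ_[p] : Γ_{ℚ_p} → Γ_ℚ` (a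
decomposition group at a place of `ℚ̄` above `p`).  Hence
`serreWeight p ρ̄ (LocalRestrictionAt.padic p ρ̄) ι` is Serre's `k(ρ̄)` computed at the `p`-adic
place, for any residue embedding `ι`.
Ref: Serre, Duke Math. J. 54 (1987), §2.1 ("`G_p = Gal(ℚ̄_p/ℚ_p)` … le choix d'une place de `ℚ̄`
prolongeant `p`"), §2.2–2.4. [folklore] -/
def LocalRestrictionAt.padic (p : ℕ) [Fact p.Prime] (ρ : ModPGaloisRep ℚ k 2) :
    LocalRestrictionAt p ρ where
  F := ℚ_[p]
  isNonarchimedeanLocalField := Padic.isNonarchimedeanLocalField_holds p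
  residueFieldCard_eq := Padic.residueFieldCard_eq p
  irreducible_natCast := Padic.irreducible_natCast_valuationInteger p
  rep := FramedGaloisRep.restrictField ℚ_[p] ρ
  rep_eq_restrictField := rfl

/-- The field of the `p`-adic datum is `ℚ_[p]`. [folklore] -/
@[simp] theorem LocalRestrictionAt.padic_F (p : ℕ) [Fact p.Prime] (ρ : ModPGaloisRep ℚ k 2) :
    (LocalRestrictionAt.padic p ρ).F = ℚ_[p] :=
  rfl

/-- The local representation of the `p`-adic datum is `ρ̄.restrictField ℚ_[p]`, i.e. its value
at `σ ∈ Γ_{ℚ_p}` is `ρ̄ (absGaloisRestrict ℚ ℚ_[p] σ)`. [folklore] -/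
theorem LocalRestrictionAt.padic_rep_apply (p : ℕ) [Fact p.Prime] (ρ : ModPGaloisRep ℚ k 2)
    (σ : absoluteGaloisGroup ℚ_[p]) :
    (LocalRestrictionAt.padic p ρ).rep σ = ρ (absGaloisRestrict ℚ ℚ_[p] σ) :=
  rfl

end ModPGaloisRep

end Literature.NumberTheory.GaloisRepresentations
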